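import Summits.FinalStateConjecture.FinalStateConjecture.Theorems.EIHFluxBalanceInertialRecessionStubSlavingCoercivity
import Summits.FinalStateConjecture.FinalStateConjecture.Theorems.EIHFluxBalanceInertialRecessionStubSlavingHelpers
import Literature.Geometry.Lorentzian.KerrEnergyIdentity
import Literature.Geometry.Lorentzian.MultiCentreKerrSchild

/-!
# Route EIHFluxBalance — `InertialRecession`, line `sublinear-is-free-clean-window-charges`:
# the lab chart is an immersion near each hole at late times (for the slaving stub `stub_slaving`)

Helper file for the crux `stmt-FinalStateConjecture-10166`
(`Summit.FinalStateConjecture.FinalStateConjecture.Theses.EIHFluxBalance.InertialRecession`),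
stub `stub_slaving`. The Ricci bridge (`ricAt_deviationExtend_add_bilin_eq_zero`, file
`…StubSlavingHelpers`) reads `Ric(Φ^*g) = 0` in the lab chart wherever `dΦ` is injective; here we
prove that it IS injective near each hole at late lab times, from three clauses of the crux
antecedent only (Lorentz factors `≤ γ`, separating centres, `C⁰` deviation `→ 0` on lab slabs):

* `injective_mfderiv_of_norm_deviation_lt` — `dΦ_x` is injective wherever
  `‖(Φ^*g − g₀)(x)‖ < m ≤` the coercivity constant of `g₀(x)`;
* `norm_boostedKerrBilin_sub_minkowski_le` — `‖boostedKerrBilin Λ c M a x − η‖ ≤ 4|H(y)|‖Λ⁻¹‖²`;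
* `le_radius_poincareInv_of_le` — far in the lab ⇒ large painted radius, linearly;
* `eventually_injective_mfderiv_near_hole` — **for the crux's modulated background**, at late lab
  times the chart map is an immersion on every hole-following region
  `{x⁰ = t, ‖x̲ − ξᵢ(t)‖ ≤ R, rᵢ ≥ r₀ > 0}`;
* `exists_ricAt_eq_zero_near_hole` — **capstone: the vacuum equations in the lab chart near each
  hole at late times**: for a vacuum Cauchy development and a lab chart as in the crux antecedent
  (smooth motions, Lorentz factors `≤ γ`, separating centres, smooth `Φ`, `C⁰` deviation `→ 0`),
  there is `T` with `ricAt ((Φ^*g − g₀) + g₀) x = 0` AND `D(ricAt …) x = 0` at every chart point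
  with `x⁰ > T`, `‖x̲ − ξᵢ(x⁰)‖ < R`, `rᵢ(x) > r₀` (the Ricci bridge of `…StubSlavingHelpers` on the
  open hole-following tube, where `dΦ` is injective by the above) — the `C¹` vacuum input of the
  slaving analysis.
-/

set_option linter.dupNamespace false
set_option maxSynthPendingDepth 3

noncomputable section

open scoped Topology Manifold ContDiff
open Filter Set Function TopologicalSpace Literature.Geometry.Lorentzian
  Summit.FinalStateConjecture.FinalStateConjecture.Theorems

namespace Summit.FinalStateConjecture.FinalStateConjecture.Theorems.SublinearIsFree.Slaving

/-! ### The lab chart is an immersion near each hole at late times -/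

section Immersion

variable (𝓢 : Spacetime 4)

/-- **The chart differential is injective wherever the deviation is smaller than the coercivity
constant of the reference field**: if `m ‖v‖ ≤ ‖g₀(x)(v, ·)‖` for all `v` and
`‖(Φ^*g − g₀)(x)‖ < m`, then `dΦ_x` is injective — a kernel vector `v` of `dΦ_x` has
`(Φ^*g)(x)(v, ·) = 0`, so `‖g₀(x)(v, ·)‖ = ‖(Φ^*g − g₀)(x)(v, ·)‖ < m ‖v‖`. (Elementary; this is
why the `C⁰` clause of the crux hypothesis makes the lab chart an immersion at late times.)
[folklore] -/
theorem injective_mfderiv_of_norm_deviation_lt (B : ModelBackground) (Φ : B.domain → 𝓢.carrier)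
    (x : B.domain) {m : ℝ} (hm : ∀ v : E4, m * ‖v‖ ≤ ‖B.bilin x.1 v‖)
    (hdev : ‖𝓢.deviation B Φ x‖ < m) :
    Function.Injective (mfderiv 𝓘(ℝ, E4) (𝓡 4) Φ x) := by
  rw [injective_iff_map_eq_zero]
  intro v hv
  change E4 at v
  by_contra hne
  have hvpos : 0 < ‖v‖ := norm_pos_iff.mpr hne
  have hdv : 𝓢.deviation B Φ x v = -(B.bilin x.1 v) := by
    ext w
    rw [𝓢.deviation_apply, hv, map_zero, zero_apply, zero_sub, neg_apply]
  have h1 : ‖B.bilin x.1 v‖ ≤ ‖𝓢.deviation B Φ x‖ * ‖v‖ := by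
    rw [← norm_neg, ← hdv]
    exact (𝓢.deviation B Φ x).le_opNorm v
  have h2 : m * ‖v‖ < m * ‖v‖ :=
    lt_of_le_of_lt ((hm v).trans h1) (mul_lt_mul_of_pos_right hdev hvpos)
  exact lt_irrefl _ h2

/-- **`C⁰` size of one painted summand**: `‖boostedKerrBilin Λ c M a x − η‖ ≤ 4|H(y)| ‖Λ⁻¹‖²`,
`y = Λ⁻¹(x − c)` (`g − η = 2Hℓ⊗ℓ` pulled back by `Λ⁻¹`, Lorentz invariance of `η`, `‖ℓ‖ ≤ √2`).
[folklore] -/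
theorem norm_boostedKerrBilin_sub_minkowski_le (Λ : lorentzGroup) (c : E4) (M a : ℝ) {x : E4}
    (hx : 0 < Kerr.radius a (poincareInv Λ c x)) :
    ‖boostedKerrBilin Λ c M a x - Minkowski.bilin‖ ≤
      4 * |Kerr.scalarH M a (poincareInv Λ c x)| * ‖((Λ : E4 ≃L[ℝ] E4).symm : E4 →L[ℝ] E4)‖ ^ 2 := by
  set Li : E4 →L[ℝ] E4 := ((Λ : E4 ≃L[ℝ] E4).symm : E4 →L[ℝ] E4) with hLi
  set y := poincareInv Λ c x with hy
  have h0 : 0 ≤ 4 * |Kerr.scalarH M a y| * ‖Li‖ ^ 2 := by positivity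
  refine ContinuousLinearMap.opNorm_le_bound _ h0 fun v ↦ ?_
  refine ContinuousLinearMap.opNorm_le_bound _ (by positivity) fun w ↦ ?_
  rw [boostedKerrBilin_sub_minkowski_apply, ← hy, sub_apply, sub_apply, Kerr.bilin_apply, add_sub_cancel_left, Real.norm_eq_abs, abs_mul,
    abs_mul, abs_mul, abs_two]
  have hv : |Kerr.nullCovector a y ((Λ : E4 ≃L[ℝ] E4).symm v)| ≤ √2 * (‖Li‖ * ‖v‖) :=
    (abs_nullCovector_apply_le hx _).trans (by gcongr; exact Li.le_opNorm v)
  have hw : |Kerr.nullCovector a y ((Λ : E4 ≃L[ℝ] E4).symm w)| ≤ √2 * (‖Li‖ * ‖w‖) :=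
    (abs_nullCovector_apply_le hx _).trans (by gcongr; exact Li.le_opNorm w)
  have hs : √2 * √2 = 2 := Real.mul_self_sqrt (by norm_num)
  calc 2 * |Kerr.scalarH M a y| * (|Kerr.nullCovector a y ((Λ : E4 ≃L[ℝ] E4).symm v)| *
        |Kerr.nullCovector a y ((Λ : E4 ≃L[ℝ] E4).symm w)|)
      ≤ 2 * |Kerr.scalarH M a y| * ((√2 * (‖Li‖ * ‖v‖)) * (√2 * (‖Li‖ * ‖w‖))) := by
        gcongr
    _ = 4 * |Kerr.scalarH M a y| * ‖Li‖ ^ 2 * ‖v‖ * ‖w‖ := by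
        linear_combination (2 * |Kerr.scalarH M a y| * ‖Li‖ ^ 2 * ‖v‖ * ‖w‖) * hs

/-- **Far in the lab ⇒ large painted radius, linearly**: on the lab slab through the centre,
`‖x̲ − ξ‖ ≥ |a| + L`, `L ≥ 0` imply `r_a(Λ⁻¹(x − (t, ξ))) ≥ L`
(`sq_sub_sq_le_radius_poincareInv_sq`). [folklore] -/
theorem le_radius_poincareInv_of_le (Λ : lorentzGroup) (a t : ℝ) (ξ : E3) {x : E4} (hx : x 0 = t)
    {L : ℝ} (hL : 0 ≤ L) (hfar : |a| + L ≤ ‖E4.spatial x - ξ‖) :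
    L ≤ Kerr.radius a (poincareInv Λ (E4.ofTimeSpace t ξ) x) := by
  have h1 := sq_sub_sq_le_radius_poincareInv_sq Λ a t ξ hx
  have h2 : L ^ 2 ≤ Kerr.radius a (poincareInv Λ (E4.ofTimeSpace t ξ) x) ^ 2 := by
    have h3 : (|a| + L) ^ 2 ≤ ‖E4.spatial x - ξ‖ ^ 2 :=
      pow_le_pow_left₀ (by positivity) hfar 2
    nlinarith [sq_abs a, abs_nonneg a]
  exact (pow_le_pow_iff_left₀ hL (Kerr.radius_nonneg _ _) two_ne_zero).mp h2

/-- **The lab chart of a modulated multi-Kerr–Schild background is an immersion near each hole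
at late times.** Hypotheses (clauses of the crux antecedent, with the `C⁰` deviation only):
Lorentz factors `≤ γ`, pairwise separating centres, and `C⁰` deviation `→ 0` on the lab slabs of
the background `η + Σⱼ (boostedKerrBilin (Λⱼ(x⁰)) (x⁰, ξⱼ(x⁰)) Mⱼ aⱼ − η)`. Conclusion: for every
hole `i`, lab radius `R` and painted floor `r₀ > 0`, eventually in `t`, `dΦ_x` is injective at
every chart point `x` of the slab `{x⁰ = t}` with `‖x̲ − ξᵢ(t)‖ ≤ R` and `rᵢ(x) ≥ r₀`. Proof:
hole `i`'s summand is `m`-coercive there (`norm_le_const_mul_norm_boostedKerrBilin`), the other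
summands have norm `≤ 4|Mⱼ|‖Λⱼ⁻¹‖²/L → 0` since `‖x̲ − ξⱼ(t)‖ ≥ ‖ξᵢ − ξⱼ‖ − R → ∞`, and the
deviation is eventually `< m/4` (`injective_mfderiv_of_norm_deviation_lt`). [folklore] -/
theorem eventually_injective_mfderiv_near_hole {N : ℕ} {M a : Fin N → ℝ}
    {Λ : Fin N → ℝ → lorentzGroup} {ξ : Fin N → ℝ → E3} {γ : ℝ} {U : Opens E4}
    (hγ : ∀ i t, |((Λ i t : E4 ≃L[ℝ] E4) (E4.basisVector 0)) 0| ≤ γ)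
    (hsep : ∀ i j, i ≠ j → Tendsto (fun t ↦ ‖ξ i t - ξ j t‖) atTop atTop)
    {Φ : U → 𝓢.carrier}
    (hdev : Tendsto (fun t ↦ 𝓢.deviationCk ⟨U, fun x ↦ Minkowski.bilin +
      ∑ i, (boostedKerrBilin (Λ i (x 0)) (E4.ofTimeSpace (x 0) (ξ i (x 0))) (M i) (a i) x -
        Minkowski.bilin), fun x ↦ x 0, E4.spatialNorm⟩ Φ 0 t) atTop (𝓝 0))
    (i : Fin N) (R : ℝ) {r₀ : ℝ} (hr₀ : 0 < r₀) :
    ∀ᶠ t in atTop, ∀ x : U, x.1 0 = t → ‖E4.spatial x.1 - ξ i t‖ ≤ R →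
      r₀ ≤ Kerr.radius (a i) (poincareInv (Λ i t) (E4.ofTimeSpace t (ξ i t)) x.1) →
      Function.Injective (mfderiv 𝓘(ℝ, E4) (𝓡 4) Φ x) := by
  set B : ModelBackground := ⟨U, fun x ↦ Minkowski.bilin +
      ∑ i, (boostedKerrBilin (Λ i (x 0)) (E4.ofTimeSpace (x 0) (ξ i (x 0))) (M i) (a i) x -
        Minkowski.bilin), fun x ↦ x 0, E4.spatialNorm⟩ with hB
  -- sizes
  have hN : (0 : ℝ) < N := by exact_mod_cast Fin.pos i
  have hγ1 : 1 ≤ γ := (one_le_abs_lorentz_apply_zero (Λ i 0)).trans (hγ i 0)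
  set K : ℝ := (1 + 3 * γ) ^ 2 * (1 + 4 * (|M i| / r₀)) with hK
  have hK1 : 1 ≤ K := by
    have h1 : (1 : ℝ) ≤ (1 + 3 * γ) ^ 2 := by nlinarith
    have h2 : (1 : ℝ) ≤ 1 + 4 * (|M i| / r₀) := by
      have : 0 ≤ |M i| / r₀ := by positivity
      linarith
    nlinarith
  have hK0 : 0 < K := by linarith
  set m : ℝ := K⁻¹ with hm
  have hm0 : 0 < m := inv_pos.mpr hK0
  set L : ℝ := 8 * N * (1 + 3 * γ) ^ 2 * (∑ j, |M j| + 1) / m with hL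
  have hL0 : 0 < L := by positivity
  -- eventually the other centres are far and the deviation is small
  have E1 : ∀ j, ∀ᶠ t in atTop, j ≠ i → R + (|a j| + L) ≤ ‖ξ i t - ξ j t‖ := by
    intro j
    by_cases hij : j = i
    · exact Eventually.of_forall fun t h ↦ (h hij).elim
    · exact ((hsep i j (Ne.symm hij)).eventually_ge_atTop _).mono fun t ht _ ↦ ht
  have E2 : ∀ᶠ t in atTop, 𝓢.deviationCk B Φ 0 t < ENNReal.ofReal (m / 4) :=
    (tendsto_order.1 hdev).2 _ (ENNReal.ofReal_pos.2 (by positivity))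
  filter_upwards [eventually_all.2 E1, E2] with t ht1 ht2 x hx0 hxR hxr
  -- (1) hole `i` is `m`-coercive at `x`
  have hcoer : ∀ v : E4, m * ‖v‖ ≤
      ‖boostedKerrBilin (Λ i t) (E4.ofTimeSpace t (ξ i t)) (M i) (a i) x.1 v‖ := by
    intro v
    rw [hm, inv_mul_le_iff₀ hK0]
    exact norm_le_const_mul_norm_boostedKerrBilin (Λ i t) _ (M i) (a i) (hγ i t) hr₀ hxr v
  -- (2) the other summands are small at `x`
  have hcross : ∀ j, j ≠ i →
      ‖boostedKerrBilin (Λ j t) (E4.ofTimeSpace t (ξ j t)) (M j) (a j) x.1 - Minkowski.bilin‖ ≤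
        m / (2 * N) := by
    intro j hij
    have hfar : |a j| + L ≤ ‖E4.spatial x.1 - ξ j t‖ := by
      have htri : ‖ξ i t - ξ j t‖ ≤ ‖E4.spatial x.1 - ξ i t‖ + ‖E4.spatial x.1 - ξ j t‖ := by
        calc ‖ξ i t - ξ j t‖ = ‖(E4.spatial x.1 - ξ j t) - (E4.spatial x.1 - ξ i t)‖ := by
              congr 1; abel
          _ ≤ ‖E4.spatial x.1 - ξ j t‖ + ‖E4.spatial x.1 - ξ i t‖ := norm_sub_le _ _
          _ = _ := add_comm _ _
      linarith [ht1 j hij]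
    have hrL : L ≤ Kerr.radius (a j) (poincareInv (Λ j t) (E4.ofTimeSpace t (ξ j t)) x.1) :=
      le_radius_poincareInv_of_le (Λ j t) (a j) t (ξ j t) hx0 hL0.le hfar
    have hrpos : 0 < Kerr.radius (a j) (poincareInv (Λ j t) (E4.ofTimeSpace t (ξ j t)) x.1) :=
      hL0.trans_le hrL
    have h1 := norm_boostedKerrBilin_sub_minkowski_le (Λ j t) (E4.ofTimeSpace t (ξ j t)) (M j) (a j)
      hrpos
    have hH : |Kerr.scalarH (M j) (a j) (poincareInv (Λ j t) (E4.ofTimeSpace t (ξ j t)) x.1)| ≤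
        |M j| / L :=
      (abs_scalarH_le (M j) (a j) hrpos).trans (div_le_div_of_nonneg_left (abs_nonneg _) hL0 hrL)
    have hLi : ‖(((Λ j t : E4 ≃L[ℝ] E4).symm : E4 →L[ℝ] E4))‖ ^ 2 ≤ (1 + 3 * γ) ^ 2 :=
      pow_le_pow_left₀ (norm_nonneg _) ((norm_lorentz_symm_le' (Λ j t)).trans (by
        linarith [hγ j t])) 2
    have hMj : |M j| ≤ ∑ k, |M k| + 1 :=
      (Finset.single_le_sum (fun k _ ↦ abs_nonneg (M k)) (Finset.mem_univ j)).trans (by linarith)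
    calc ‖boostedKerrBilin (Λ j t) (E4.ofTimeSpace t (ξ j t)) (M j) (a j) x.1 - Minkowski.bilin‖
        ≤ 4 * (|M j| / L) * (1 + 3 * γ) ^ 2 := h1.trans (by gcongr)
      _ ≤ 4 * ((∑ k, |M k| + 1) / L) * (1 + 3 * γ) ^ 2 := by gcongr
      _ = m / (2 * N) := by
          rw [hL]
          field_simp
          ring
  -- (3) hence the full reference field is `m/2`-coercive at `x`
  have hsum : B.bilin x.1 = boostedKerrBilin (Λ i t) (E4.ofTimeSpace t (ξ i t)) (M i) (a i) x.1 +
      ∑ j ∈ Finset.univ.erase i, (boostedKerrBilin (Λ j t) (E4.ofTimeSpace t (ξ j t)) (M j) (a j)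
        x.1 - Minkowski.bilin) := by
    show Minkowski.bilin + ∑ j, (boostedKerrBilin (Λ j (x.1 0)) (E4.ofTimeSpace (x.1 0)
      (ξ j (x.1 0))) (M j) (a j) x.1 - Minkowski.bilin) = _
    rw [hx0, ← Finset.add_sum_erase _ _ (Finset.mem_univ i)]
    abel
  have hE : ‖∑ j ∈ Finset.univ.erase i, (boostedKerrBilin (Λ j t) (E4.ofTimeSpace t (ξ j t)) (M j)
      (a j) x.1 - Minkowski.bilin)‖ ≤ m / 2 := by
    refine (norm_sum_le (Finset.univ.erase i) fun j ↦ boostedKerrBilin (Λ j t)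
      (E4.ofTimeSpace t (ξ j t)) (M j) (a j) x.1 - Minkowski.bilin).trans ?_
    calc ∑ j ∈ Finset.univ.erase i, ‖boostedKerrBilin (Λ j t) (E4.ofTimeSpace t (ξ j t)) (M j)
          (a j) x.1 - Minkowski.bilin‖
        ≤ ∑ j ∈ Finset.univ.erase i, m / (2 * N) :=
          Finset.sum_le_sum fun j hj ↦ hcross j (Finset.ne_of_mem_erase hj)
      _ ≤ ∑ _j : Fin N, m / (2 * N) :=
          Finset.sum_le_sum_of_subset_of_nonneg (Finset.erase_subset _ _)
            fun _ _ _ ↦ by positivity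
      _ = m / 2 := by
          rw [Finset.sum_const, Finset.card_univ, Fintype.card_fin, nsmul_eq_mul]
          field_simp
  have hm' : ∀ v : E4, m / 2 * ‖v‖ ≤ ‖B.bilin x.1 v‖ := by
    intro v
    rw [hsum, show m / 2 = m - m / 2 by ring]
    exact coercive_add_of_norm_le hcoer hE v
  -- (4) and the deviation at `x` is `< m/4 ≤ m/2`
  have hmem : x.1 ∈ Subtype.val '' B.timeSlab t := ⟨x, hx0, rfl⟩
  have hdx : ‖𝓢.deviation B Φ x‖ < m / 2 := by
    have h1 := enorm_iteratedFDeriv_le_supCkENorm (le_refl 0) hmem (𝓢.deviationExtend B Φ)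
    rw [← ofReal_norm, norm_iteratedFDeriv_zero, 𝓢.deviationExtend_coe] at h1
    have h2 : ENNReal.ofReal ‖𝓢.deviation B Φ x‖ < ENNReal.ofReal (m / 4) := h1.trans_lt ht2
    rw [ENNReal.ofReal_lt_ofReal_iff (by positivity)] at h2
    linarith
  exact injective_mfderiv_of_norm_deviation_lt 𝓢 B Φ x hm' hdx

end Immersion

/-! ### Capstone: `Ric = 0` in the lab chart near each hole at late times -/

/-- The painted radius of hole `i` is a continuous function of the lab point when the motion is
continuous (`Λ(x⁰)⁻¹(x − (x⁰, ξ(x⁰)))`). [folklore] -/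
theorem continuous_paintedRadius {Λ : ℝ → lorentzGroup} {ξ : ℝ → E3} (a : ℝ)
    (hΛ : Continuous (fun s ↦ (((Λ s : E4 ≃L[ℝ] E4).symm : E4 →L[ℝ] E4))))
    (hξ : Continuous ξ) :
    Continuous (fun x : E4 ↦ Kerr.radius a (poincareInv (Λ (x 0)) (E4.ofTimeSpace (x 0) (ξ (x 0))) x)) := by
  have h0 : Continuous (fun x : E4 ↦ x 0) := (EuclideanSpace.proj (0 : Fin 4)).continuous
  have hc : Continuous (fun x : E4 ↦ E4.ofTimeSpace (x 0) (ξ (x 0))) := by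
    have : (fun x : E4 ↦ E4.ofTimeSpace (x 0) (ξ (x 0))) =
        fun x ↦ (x 0) • E4.basisVector 0 + E4.spaceEmbed (ξ (x 0)) :=
      funext fun x ↦ E4.ofTimeSpace_eq_smul_add' (x 0) (ξ (x 0))
    rw [this]
    exact (h0.smul continuous_const).add (E4.spaceEmbed.continuous.comp (hξ.comp h0))
  have hp : Continuous (fun x : E4 ↦ poincareInv (Λ (x 0)) (E4.ofTimeSpace (x 0) (ξ (x 0))) x) :=
    (hΛ.comp h0).clm_apply (continuous_id.sub hc)
  exact (Kerr.continuous_radius a).comp hp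

/-- **The Einstein vacuum equations in the lab chart of the crux hypothesis, near each hole at late
times.** For a vacuum Cauchy development `𝒟`, painted moduli with smooth motions, Lorentz factors
`≤ γ` and separating centres, and a smooth chart map `Φ : U → 𝒟` whose `C⁰` deviation from the
modulated background tends to `0` on the lab slabs: for every hole `i`, lab radius `R` and painted
floor `r₀ > 0` there is a lab time `T` after which the coordinate Ricci form of the lab components
`(Φ^*g − g₀) + g₀ = Φ^*g` vanishes, together with its derivative, at every chart point of the
hole-following tube `{x⁰ > T, ‖x̲ − ξᵢ(x⁰)‖ < R, rᵢ(x) > r₀}` (`eventually_injective_mfderiv_near_hole`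
makes `Φ` an immersion on this open tube; `ricAt_deviationExtend_add_bilin_eq_zero_of_vacuum`; the
derivative of a function vanishing on an open set vanishes). This is the `C¹` input of the slaving
analysis (`Ric` of the frozen ansatz `g₀` is then `C¹`-close to `0` there, up to the deviation).
[folklore] -/
theorem exists_ricAt_eq_zero_near_hole
    {X : Type*} [TopologicalSpace X] [ChartedSpace E3 X] [IsManifold (𝓡 3) ∞ X]
    [ConnectedSpace X] {D : InitialDataSet (𝓡 3) X} (𝒟 : VacuumCauchyDevelopment D)
    {N : ℕ} {M a : Fin N → ℝ} {Λ : Fin N → ℝ → lorentzGroup} {ξ : Fin N → ℝ → E3} {γ : ℝ}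
    {U : Opens E4}
    (hγ : ∀ i t, |((Λ i t : E4 ≃L[ℝ] E4) (E4.basisVector 0)) 0| ≤ γ)
    (hsm : ∀ i, ContDiff ℝ ((⊤ : ℕ∞) : WithTop ℕ∞) (ξ i) ∧
      ContDiff ℝ ((⊤ : ℕ∞) : WithTop ℕ∞) (fun t ↦ ((Λ i t : E4 ≃L[ℝ] E4) : E4 →L[ℝ] E4)))
    (hsep : ∀ i j, i ≠ j → Tendsto (fun t ↦ ‖ξ i t - ξ j t‖) atTop atTop)
    {Φ : U → 𝒟.carrier} (hΦ : ContMDiff 𝓘(ℝ, E4) (𝓡 4) ∞ Φ)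
    (hdev : Tendsto (fun t ↦ 𝒟.toSpacetime.deviationCk ⟨U, fun x ↦ Minkowski.bilin +
      ∑ i, (boostedKerrBilin (Λ i (x 0)) (E4.ofTimeSpace (x 0) (ξ i (x 0))) (M i) (a i) x -
        Minkowski.bilin), fun x ↦ x 0, E4.spatialNorm⟩ Φ 0 t) atTop (𝓝 0))
    (i : Fin N) (R : ℝ) {r₀ : ℝ} (hr₀ : 0 < r₀) :
    ∃ T : ℝ, ∀ x : U, T < x.1 0 → ‖E4.spatial x.1 - ξ i (x.1 0)‖ < R →
      r₀ < Kerr.radius (a i) (poincareInv (Λ i (x.1 0)) (E4.ofTimeSpace (x.1 0) (ξ i (x.1 0))) x.1) →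
      MetricCoord.ricAt (fun z ↦ 𝒟.toSpacetime.deviationExtend ⟨U, fun x ↦ Minkowski.bilin +
        ∑ i, (boostedKerrBilin (Λ i (x 0)) (E4.ofTimeSpace (x 0) (ξ i (x 0))) (M i) (a i) x -
          Minkowski.bilin), fun x ↦ x 0, E4.spatialNorm⟩ Φ z + (Minkowski.bilin +
        ∑ i, (boostedKerrBilin (Λ i (z 0)) (E4.ofTimeSpace (z 0) (ξ i (z 0))) (M i) (a i) z -
          Minkowski.bilin))) x.1 = 0 ∧
      fderiv ℝ (MetricCoord.ricAt (fun z ↦ 𝒟.toSpacetime.deviationExtend ⟨U, fun x ↦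
        Minkowski.bilin + ∑ i, (boostedKerrBilin (Λ i (x 0)) (E4.ofTimeSpace (x 0) (ξ i (x 0)))
          (M i) (a i) x - Minkowski.bilin), fun x ↦ x 0, E4.spatialNorm⟩ Φ z + (Minkowski.bilin +
        ∑ i, (boostedKerrBilin (Λ i (z 0)) (E4.ofTimeSpace (z 0) (ξ i (z 0))) (M i) (a i) z -
          Minkowski.bilin)))) x.1 = 0 := by
  set B : ModelBackground := ⟨U, fun x ↦ Minkowski.bilin +
      ∑ i, (boostedKerrBilin (Λ i (x 0)) (E4.ofTimeSpace (x 0) (ξ i (x 0))) (M i) (a i) x -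
        Minkowski.bilin), fun x ↦ x 0, E4.spatialNorm⟩ with hB
  obtain ⟨T, hT⟩ := eventually_atTop.1
    (eventually_injective_mfderiv_near_hole 𝒟.toSpacetime hγ hsep (Φ := Φ) hdev i R hr₀)
  refine ⟨T, fun x hxT hxR hxr ↦ ?_⟩
  -- the open hole-following tube
  have hrad : Continuous (fun z : E4 ↦ Kerr.radius (a i)
      (poincareInv (Λ i (z 0)) (E4.ofTimeSpace (z 0) (ξ i (z 0))) z)) :=
    continuous_paintedRadius (a i) (contDiff_lorentz_symm (hsm i).2).continuous (hsm i).1.continuous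
  have hdist : Continuous (fun z : E4 ↦ ‖E4.spatial z - ξ i (z 0)‖) :=
    (E4.spatial.continuous.sub
      ((hsm i).1.continuous.comp (EuclideanSpace.proj (0 : Fin 4)).continuous)).norm
  let A : Opens E4 := ⟨{z : E4 | z ∈ (U : Set E4) ∧ T < z 0 ∧ ‖E4.spatial z - ξ i (z 0)‖ < R ∧
      r₀ < Kerr.radius (a i) (poincareInv (Λ i (z 0)) (E4.ofTimeSpace (z 0) (ξ i (z 0))) z)},
    U.isOpen.inter ((isOpen_lt continuous_const (EuclideanSpace.proj (0 : Fin 4)).continuous).inter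
      ((isOpen_lt hdist continuous_const).inter (isOpen_lt continuous_const hrad)))⟩
  have hA : A ≤ B.domain := fun z hz ↦ hz.1
  have hinj : ∀ y : A, Function.Injective
      (mfderiv 𝓘(ℝ, E4) (𝓡 4) Φ (Opens.inclusion hA y)) := by
    intro y
    obtain ⟨hyU, hyT, hyR, hyr⟩ := y.2
    exact hT (y.1 0) hyT.le ⟨y.1, hyU⟩ rfl hyR.le hyr.le
  -- `Ric = 0` on the whole open tube, hence also `D Ric = 0` there
  have hzero : ∀ z ∈ (A : Set E4),
      MetricCoord.ricAt (fun z ↦ 𝒟.toSpacetime.deviationExtend B Φ z + B.bilin z) z = 0 :=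
    fun z hz ↦ ContinuousLinearMap.ext fun v ↦ ContinuousLinearMap.ext fun w ↦
      ricAt_deviationExtend_add_bilin_eq_zero_of_vacuum 𝒟 B hΦ hA hinj ⟨z, hz⟩ v w
  have hx : x.1 ∈ A := ⟨x.2, hxT, hxR, hxr⟩
  have hev : MetricCoord.ricAt (fun z ↦ 𝒟.toSpacetime.deviationExtend B Φ z + B.bilin z) =ᶠ[𝓝 x.1]
      fun _ ↦ 0 :=
    Filter.eventually_of_mem (A.isOpen.mem_nhds hx) hzero
  refine ⟨hzero x.1 hx, ?_⟩
  rw [hev.fderiv_eq]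
  exact fderiv_const_apply 0

/-- **Registered sub-goal form** (stub `slaving_ricAt_eq_zero_near_hole` of the crux item) of
`exists_ricAt_eq_zero_near_hole`: the vacuum equations and their first derivative in the lab chart
of the crux hypothesis, on hole-following tubes at late times. [folklore] -/
theorem slaving_ricAt_eq_zero_near_hole : open Literature.Geometry.Lorentzian Filter Topology in ∀ {X : Type} [TopologicalSpace X] [ChartedSpace E3 X] [IsManifold (𝓡 3) ((⊤ : ℕ∞) : WithTop ℕ∞) X] [ConnectedSpace X] {D : InitialDataSet (𝓡 3) X} (𝒟 : VacuumCauchyDevelopment D) {N : ℕ} {M a : Fin N → ℝ} {Λ : Fin N → ℝ → lorentzGroup} {ξ : Fin N → ℝ → E3} {γ : ℝ} {U : Opens E4}, (∀ i t, |((Λ i t : E4 ≃L[ℝ] E4) (E4.basisVector 0)) 0| ≤ γ) → (∀ i, ContDiff ℝ ((⊤ : ℕ∞) : WithTop ℕ∞) (ξ i) ∧ ContDiff ℝ ((⊤ : ℕ∞) : WithTop ℕ∞) (fun t ↦ ((Λ i t : E4 ≃L[ℝ] E4) : E4 →L[ℝ] E4))) → (∀ i j, i ≠ j → Tendsto (fun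 t ↦ ‖ξ i t - ξ j t‖) atTop atTop) → ∀ {Φ : U → 𝒟.carrier}, ContMDiff 𝓘(ℝ, E4) (𝓡 4) ((⊤ : ℕ∞) : WithTop ℕ∞) Φ → Tendsto (fun t ↦ 𝒟.toSpacetime.deviationCk ⟨U, fun x ↦ Minkowski.bilin + ∑ i, (boostedKerrBilin (Λ i (x 0)) (E4.ofTimeSpace (x 0) (ξ i (x 0))) (M i) (a i) x - Minkowski.bilin), fun x ↦ x 0, E4.spatialNorm⟩ Φ 0 t) atTop (𝓝 0) → ∀ (i : Fin N) (R : ℝ) {r₀ : ℝ}, 0 < r₀ → ∃ T : ℝ, ∀ x : U, T < x.1 0 → ‖E4.spatial x.1 - ξ i (x.1 0)‖ < R → r₀ < Kerr.radius (a i) (poincareInv (Λ i (x.1 0)) (E4.ofTimeSpace (x.1 0) (ξ i (x.1 0))) x.1) → MetricCoord.ricAt (fun z ↦ 𝒟.toSpacetime.deviationExtend ⟨U, fun x ↦ Minkowski.bilin + ∑ i, (boostedKerrBilin (Λ i (x 0)) (E4.ofTimeSpace (x 0) (ξ i (x 0))) (M i) (a i) x - Minkowski.bilin), fun x ↦ x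 0, E4.spatialNorm⟩ Φ z + (Minkowski.bilin + ∑ i, (boostedKerrBilin (Λ i (z 0)) (E4.ofTimeSpace (z 0) (ξ i (z 0))) (M i) (a i) z - Minkowski.bilin))) x.1 = 0 ∧ fderiv ℝ (MetricCoord.ricAt (fun z ↦ 𝒟.toSpacetime.deviationExtend ⟨U, fun x ↦ Minkowski.bilin + ∑ i, (boostedKerrBilin (Λ i (x 0)) (E4.ofTimeSpace (x 0) (ξ i (x 0))) (M i) (a i) x - Minkowski.bilin), fun x ↦ x 0, E4.spatialNorm⟩ Φ z + (Minkowski.bilin + ∑ i, (boostedKerrBilin (Λ i (z 0)) (E4.ofTimeSpace (z 0) (ξ i (z 0))) (M i) (a i) z - Minkowski.bilin)))) x.1 = 0 :=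
  fun 𝒟 _ _ _ _ _ _ _ hγ hsm hsep _ hΦ hdev i R _ hr₀ ↦
    exists_ricAt_eq_zero_near_hole 𝒟 hγ hsm hsep hΦ hdev i R hr₀

end Summit.FinalStateConjecture.FinalStateConjecture.Theorems.SublinearIsFree.Slaving

end
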